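import Literature.NumberTheory.EllipticCurves.KatoRankBoundAllPrimesProofs
import Literature.NumberTheory.EllipticCurves.Wuthrich2014.SurjectiveMultiplicativeDivisibility
import Literature.NumberTheory.EllipticCurves.Wuthrich2014.ReducibleMultiplicativeDivisibility
import Literature.NumberTheory.EllipticCurves.Skinner2016.MultiplicativeMainConjecture
import Literature.NumberTheory.EllipticCurves.PAdicBSDSplitMultiplicativeProofs
import Literature.NumberTheory.EllipticCurves.ModularFormsGamma0Genus
import HarnessLib

/-!
# BSD family — Kato's bound `corank Sel_{p^∞}(E/ℚ) ≤ ord_{s=1} L_p(E, s)` at a prime of MULTIPLICATIVE reduction (Astérisque 295, Thm 18.4, both clauses): reduction to the published `Λ`-adic divisibility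

Companion ("Proofs") file — theorems only, no definition, no new named fact (D-0026) — to
`Literature.NumberTheory.EllipticCurves.KatoRankBound` (Kato's Thm. 18.4 at a GOOD ORDINARY prime,
named facts `kato_selmerCorank_le_order_padicLFunction[_allPrimes]`) and
`Literature.NumberTheory.EllipticCurves.KatoRankBoundAllPrimesProofs` (the algebra of Kato's
reduction 18.4 ⇐ 17.4 (1)(2), proved parity-free). HONEST FRAMING (cell `bsd-rank2`, D-0036, the
lane p2 "kernel audit" of «rank ≤ corank Sel_{p^∞} ≤ ord_T L_p(E,T) for all `E`»): this file settles
what the tree PROVES at a prime `p ‖ N`. Nothing here reads an analytic rank, and nothing is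
"finishing BSD".

**Source, as printed.** K. Kato, *`p`-adic Hodge theory and values of zeta functions of modular
forms*, Astérisque 295 (2004) 117–290, §18.1 (p. 280): "Assume that there is `α ∈ F_λ` such that
`1 - αu` divides `1 - a_p u + ε(p)p^{k-1}u²` and such that `ord_p(α) < k - 1`" — for `k = 2` and a
prime `p ∣ N` of multiplicative reduction, `ε(p) = 0` and `α = a_p ∈ {1, -1}`; Remark 18.3 (p. 281):
"In the case `k = 2` and `f` corresponds to an elliptic curve `E` over `ℚ`, `α = 1` if and only if
`E ⊗ ℚ_p` is a Tate curve"; **Theorem 18.4** (p. 281): "Let `T` be a `Gal(ℚ̄/ℚ)`-stable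
`O_λ`-lattice of `V_{F_λ}(f)(k/2)`. Then we have `≤` in place of `=` in Conj. 18.2. That is,
`corank_{O_λ}(Sel(T)) ≤ ord_{s=k/2}(L_{p-adic,α}(f))` if `α ≠ p^{(k-2)/2}`,
`corank_{O_λ}(Sel(T)) ≤ ord_{s=k/2}(L_{p-adic,α}(f)) - 1` if `α = p^{(k-2)/2}`. In particular, if
`k = 2`, `K = ℚ`, and `f` corresponds to an elliptic curve `E` over `ℚ`, we have
`rank(E(ℚ)) ≤ ord_{s=1}(L_{p-adic,α}(f))` if `E` is not a Tate curve, and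
`rank(E(ℚ)) ≤ ord_{s=1}(L_{p-adic,α}(f)) - 1` if `E` is a Tate curve. The arguments in the proof
below for the case `α ≠ p^{(k-2)/2}` is given in Perrin-Riou [Pe1], [Pe3]. The proof for the case
`α = p^{(k-2)/2}` will be given in [KKT], and we give below the outline of it [18.11]."
(Held OCR `paper:doi-10-24033-ast-639`, p0166; rendered in the cell memo `HOME/lit/LIT-R2.md` §1o.)
So at a multiplicative prime the printed theorem reads: `corank_{ℤ_p} Sel_{p^∞}(E/ℚ) ≤ ord L_p`
at a NON-split prime (`α = -1`), and `corank_{ℤ_p} Sel_{p^∞}(E/ℚ) ≤ ord L_p - 1` at a SPLIT prime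
(`α = 1`, the Tate-curve / exceptional-zero clause, whose proof Kato defers to the unpublished
[KKT]; for elliptic curves the missing local input — the derivative of the Coleman map, whence
`Col` has image of finite index in the augmentation ideal `I` — is S. Kobayashi, Doc. Math. Extra
Vol. Coates (2006) 567–575, Thm. 4.1 (held `paper:url-b8aba5e994cc`, p. 574), as used by
C. Wuthrich, Doc. Math. 19 (2014), §3.2 (p. 394) and Cor. 19 (p. 398): "`char_Λ(X(E))`, or
`I char_Λ(X(E))` in the split multiplicative case, divides the ideal generated by `L_p(E)`").

**What is proved here.** Exactly as for the good ordinary case (`KatoRankBoundAllPrimesProofs`: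
Kato's `V(f)`, Iwasawa cohomology and `exp*` are not in Mathlib or the tree, so Thm. 18.4 is
REDUCED to the `Λ`-adic statement Thm. 17.4 (1)(2)), the multiplicative Thm. 18.4 is reduced to the
published `Λ`-adic divisibility at `p ‖ N`, in the tree's vocabulary: `X = X(E/ℚ_∞)` the
Pontryagin dual of the classical Selmer group over the cyclotomic `ℤ_p`-extension
(`WeierstrassCurve.SelmerDualData`), `ι = iwasawaToPowerSeries p : Λ → ℚ_p⟦T⟧`, `ϖ ∈ ℚ` with
`ϖ · Ω_E = Ω⁺_f` (`ϖ ≠ 0` since `Ω⁺_f > 0`, `IsNewform0.plusPeriod_pos_holds`), and `L` THE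
`Ω⁺_f`-normalised Mazur–Tate–Teitelbaum function at `p` — `IsMultPAdicLFunctionOf f p (-1) L` at a
non-split prime, `IsSplitMultPAdicLFunctionOf f p L` at a split prime (MTT 1986 §I.10, `ε(p) = 0`;
both EXIST and the split one is unique, tree theorems `exists_isMultPAdicLFunctionOf_neg_one_of_nonsplit`,
`existsUnique_isSplitMultPAdicLFunctionOf_holds`; Kato's own `L_{p-adic,α,ω,γ}(f)` differs from it
by a non-zero constant, Astérisque 295, 17.5 / Thm. 16.2, immaterial for `ord_{s=1}`):

* `selmerCorank_succ_le_order_of_charIdeal_datum_X_mul` (**proved**, any prime): the algebra of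
  the SPLIT clause — `X` finitely generated torsion, `g ∈ char_Λ X`, `ι(T · g) = u · L` with
  `u(0) ≠ 0` ⟹ `corank_{ℤ_p} Sel_{p^∞}(E/ℚ) + 1 ≤ ord_{T=0} L`: `corank Sel ≤ rank_{ℤ_p} X/TX`
  (`WeierstrassCurve.selmerCorank_le_coinvariantsRank`, Greenberg's Lemma 3.1) `≤ ord_T g`
  (`IwasawaAlgebra.coinvariantsRank_le_order_of_mem_charIdeal`) `≤ ord_T ι g`, and
  `ord_T L = ord_T (T · ι g) = 1 + ord_T ι g`. (The non-split clause is the tree's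
  `selmerCorank_le_order_of_charIdeal_datum_of_constantCoeff_ne_zero` verbatim.)
* `selmerCorank_le_order_multiplicative_of_divisibility` (**proved**): BOTH clauses of Thm. 18.4 at
  a multiplicative prime from the divisibility datum "`X(E/ℚ_∞)` is `Λ`-torsion and
  `ϖ · L ∈ ι(char_Λ X)` (non-split) / `ϖ · L ∈ ι(T · char_Λ X)` (split)", spelled as an explicit
  hypothesis `hdiv` — the common body of the tree's three vendored divisibility facts at `p ‖ N`.
  All other inputs are parity-free, reduction-type-free tree THEOREMS: the cyclotomic setting
  (`exists_isCyclotomic_isTopGenerator_isCyclotomicVariable_holds`), the Iwasawa module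
  (`WeierstrassCurve.nonempty_selmerDualData_holds`), its finite generation
  (`WeierstrassCurve.finite_selmerInfty_pTorsion_invariants_holds` + Nakayama). No control theorem
  at `p ‖ N` (Greenberg Prop. 3.7, not in the tree) is needed — only the easy half, Lemma 3.1.
* `mordellWeilRank_le_order_multiplicative_of_divisibility` (**proved**): the printed "In
  particular" — `rank E(ℚ) ≤ ord L_p` (non-split), `rank E(ℚ) + 1 ≤ ord L_p` (split = Tate curve) —
  via the Kummer identity `corank Sel_{p^∞}(E/ℚ) = rank E(ℚ) + corank Ш[p^∞]`
  (`WeierstrassCurve.selmerCorank_eq_mordellWeilRank_add_holds`).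
* The datum `hdiv` is SUPPLIED, at an odd multiplicative prime, by each of the tree's published
  divisibility facts (**proved** instantiations; each stays a named fact = hypothesis, D-0014):
  `Wuthrich2014.kato_charIdeal_dvd_multiplicative_of_surjective` — Kato, for `ρ_{E,p^∞}`
  surjective (Wuthrich 2014 Thm. 3 + p. 383 "proven by Kato"; Cor. 19 proof, first case), whence at
  `p ≥ 5` for `ρ̄_{E,p}` surjective by Serre (tree theorem `serre_hasSurjectiveModNGaloisRep_pow_holds`);
  `Wuthrich2014.thm16_charIdeal_dvd_multiplicative_of_reducible` — Wuthrich 2014 Thm. 16, `E[p]`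
  reducible; `Skinner2016.thmA_charIdeal_multiplicative` — Skinner 2016 Thm. A, `p ≥ 3`, `E[p]`
  irreducible + (ram). Assembly `selmerCorank_le_order_multiplicative_of_five_le`: at a
  multiplicative `p ≥ 5` with `ρ̄_{E,p}` surjective OR `E[p]` reducible, Thm. 18.4 (both clauses)
  holds modulo the first two facts.

**Scope caveat (what is NOT covered).** A multiplicative prime `p` at which `ρ̄_{E,p}` is
irreducible but not surjective and no (ram) prime `ℓ ≠ p` exists is outside all three facts (cf.
Wuthrich 2014, p. 399: "the hypothesis in Corollary 19 that `E` is semi-stable can not be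
dropped"); `p = 2` is outside all three (each carries `p ≠ 2` / `3 ≤ p`); `p = 3` with `ρ̄`
surjective needs `ρ_{E,3^∞}` surjective as an input (Serre's lifting needs `p ≥ 5`). Kato prints
Thm. 18.4 with none of these restrictions; the tree vendors the `Λ`-adic input only where a
published integral divisibility exists.

## References

* [Kato2004Asterisque] K. Kato, Astérisque 295 (2004): §17.5, Thm. 17.4 (p. 273), §18.1 (p. 280),
  Rem. 18.3, Thm. 18.4 (p. 281), 18.5–18.11.
* [Wuthrich2014] C. Wuthrich, Doc. Math. 19 (2014) 381–402: Thm. 3 (p. 383), §3.2 (p. 394), §5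
  (p. 397), Thm. 16, Cor. 19 (p. 398) and its proof (p. 399).
* [Skinner2016PacificMC] C. Skinner, Pacific J. Math. 283 (2016): Thm. A, §3.2–3.3.
* S. Kobayashi, Doc. Math. Extra Vol. Coates (2006) 567–575, Thm. 4.1, Cor. 4.2.
* [GreenbergLNM1716] R. Greenberg, LNM 1716 (1999): §1 p. 65, §3 Lemma 3.1, §4 (PDF p. 113).
* [MazurTateTeitelbaum1986Invent] B. Mazur, J. Tate, J. Teitelbaum, Invent. Math. 84 (1986) §I.10,
  §I.14; Conj. of §II (BSD(p), the "`- 1`" at a split prime).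
-/

set_option autoImplicit false

noncomputable section

open scoped MatrixGroups ModularForm

open CongruenceSubgroup WeierstrassCurve Literature.NumberTheory.EllipticCurves.ModularForms

namespace Literature.NumberTheory.EllipticCurves

/-! ### The algebra of the split (Tate-curve) clause, at any prime -/

/-- **The algebra of Kato's reduction 18.4 ⇐ (`Λ`-adic divisibility) for the SPLIT clause, at any
prime `p`.** Let `E/ℚ` (model `W`), `κ` a `ℤ_p`-extension of `ℚ` with topological generator `γ`,
`D` Pontryagin-dual data for `Sel_{p^∞}(E/ℚ_∞)` with `X = D.X` finitely generated and torsion over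
`Λ = ℤ_p⟦T⟧`, `g ∈ char_Λ X`, and `ι(T · g) = u · L` in `ℚ_p⟦T⟧` for power series `u, L` with
`u(0) ≠ 0`. Then `corank_{ℤ_p} Sel_{p^∞}(E/ℚ) + 1 ≤ ord_{T=0} L`:
`corank Sel ≤ rank_{ℤ_p} X/TX` (Greenberg's Lemma 3.1, `WeierstrassCurve.selmerCorank_le_coinvariantsRank`)
`≤ ord_T g` (`IwasawaAlgebra.coinvariantsRank_le_order_of_mem_charIdeal`) `≤ ord_T ι g`, while
`ord_T L = ord_T (u · L) = ord_T (T · ι g) = 1 + ord_T ι g`. This is the shape "`I · char_Λ X`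
divides `(L_p)`" of the exceptional-zero clause (Kato Thm. 18.4, case `α = p^{(k-2)/2}`; Wuthrich
2014 Cor. 19 "or `I char_Λ(X(E))` in the split multiplicative case").
[cite: Kato2004Asterisque, Thm. 18.4 (p. 281), case α = p^{(k-2)/2}, and 18.11]
[cite: Wuthrich2014, Cor. 19 (p. 398) and §3.2 (p. 394)]
[cite: GreenbergLNM1716, §1 p. 65 and §3 Lemma 3.1] -/
theorem selmerCorank_succ_le_order_of_charIdeal_datum_X_mul
    (W : WeierstrassCurve ℚ) [W.IsElliptic] (p : ℕ) [Fact p.Prime]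
    {κ : ZpExtension ℚ p} {γ : Field.absoluteGaloisGroup ℚ} (hγ : κ.IsTopGenerator γ)
    (D : W.SelmerDualData κ γ) [Module.Finite (IwasawaAlgebra p) D.X] (htors : D.IsTorsion)
    {g : IwasawaAlgebra p} (hg : g ∈ D.charIdeal) {u L : PowerSeries ℚ_[p]}
    (hu : PowerSeries.constantCoeff u ≠ 0)
    (hιg : iwasawaToPowerSeries p (PowerSeries.X * g) = u * L) :
    (W.selmerCorank p : ℕ∞) + 1 ≤ L.order := by
  -- `corank Sel ≤ rank X/TX ≤ ord g ≤ ord (ι g)`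
  have h0 : (W.selmerCorank p : ℕ∞) ≤ (IwasawaAlgebra.coinvariantsRank p D.X : ℕ∞) := by
    exact_mod_cast W.selmerCorank_le_coinvariantsRank hγ D
  have h1 : (W.selmerCorank p : ℕ∞) ≤ PowerSeries.order g :=
    h0.trans (IwasawaAlgebra.coinvariantsRank_le_order_of_mem_charIdeal D.X htors g hg)
  have h2 : PowerSeries.order g ≤ PowerSeries.order (iwasawaToPowerSeries p g) :=
    PowerSeries.le_order_map _
  -- `ι (T g) = T · ι g`, so `ord (u L) = ord L = 1 + ord (ι g)`
  have hunit : IsUnit u :=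
    PowerSeries.isUnit_iff_constantCoeff.mpr (isUnit_iff_ne_zero.mpr hu)
  have hX : iwasawaToPowerSeries p (PowerSeries.X * g) =
      PowerSeries.X * iwasawaToPowerSeries p g := by
    rw [map_mul]
    simp [iwasawaToPowerSeries, PowerSeries.map_X]
  have h3 : L.order = PowerSeries.order (iwasawaToPowerSeries p g) + 1 := by
    have h := congrArg PowerSeries.order hιg
    rw [hX, PowerSeries.order_mul, PowerSeries.order_X, PowerSeries.order_mul,
      PowerSeries.order_zero_of_unit hunit, zero_add] at h
    rw [← h, add_comm]
  calc (W.selmerCorank p : ℕ∞) + 1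
      ≤ PowerSeries.order (iwasawaToPowerSeries p g) + 1 := add_le_add (h1.trans h2) le_rfl
    _ = L.order := h3.symm

/-! ### Kato's Thm. 18.4 at a multiplicative prime from the `Λ`-adic divisibility datum -/

section Reduction

/-- The period ratio of the divisibility facts is non-zero: if `ϖ · Ω_E = Ω⁺_f` for the newform
`f` of `W`, then `ϖ ≠ 0`, because `Ω⁺_f > 0` (`IsNewform0.plusPeriod_pos_holds`). (The same
statement is proved summit-side as `Summit.BirchSwinnertonDyer.Rank1Residual.X11b.varpi_ne_zero`,
which a Literature file cannot import; restated here for the Literature consumers below.)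
[cite: MazurTateTeitelbaum1986Invent, §I.8 (8.6)] -/
theorem ModularForms.IsNewformOf.periodRatio_ne_zero {W : WeierstrassCurve ℚ} {N : ℕ} [NeZero N]
    {f : CuspForm (Gamma0 N) 2} (hf : IsNewformOf W f) {ϖ : ℚ}
    (hϖ : (ϖ : ℝ) * W.realPeriodRat = plusPeriod f) : ϖ ≠ 0 := by
  rintro rfl
  have hpos : 0 < plusPeriod f := IsNewform0.plusPeriod_pos_holds hf.1 hf.coeffField_eq_bot
  rw [Rat.cast_zero, zero_mul] at hϖ
  exact hpos.ne hϖ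

variable (W : WeierstrassCurve ℚ) [W.IsElliptic] (p : ℕ) [Fact p.Prime] {N : ℕ}
  {f : CuspForm (Gamma0 N) 2}

/-- **Kato's Thm. 18.4 at a prime of multiplicative reduction, both clauses, from the published
`Λ`-adic divisibility at that prime** (hypothesis `hdiv`, the common body of the tree's named facts
`Wuthrich2014.kato_charIdeal_dvd_multiplicative_of_surjective`,
`Wuthrich2014.thm16_charIdeal_dvd_multiplicative_of_reducible`, and — through its projections —
`Skinner2016.thmA_charIdeal_multiplicative`): for the cyclotomic `ℤ_p`-extension `κ` of `ℚ` with
normalised topological generator `γ` and any Pontryagin-dual datum `D`, `X(E/ℚ_∞) = D.X` is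
`Λ`-torsion, and `ι g = ϖ · L` for some `g ∈ char_Λ X` at a NON-split prime (for THE function `L`,
`IsMultPAdicLFunctionOf f p (-1) L`), resp. `ι(T · g) = ϖ · L` for some `g ∈ char_Λ X` at a SPLIT
prime (`IsSplitMultPAdicLFunctionOf f p L`), where `ϖ ≠ 0`. Then — Kato, p. 281: "we have `≤` in
place of `=` in Conj. 18.2 [MTT]: `corank_{O_λ}(Sel(T)) ≤ ord_{s=k/2}(L_{p-adic,α}(f))` if
`α ≠ p^{(k-2)/2}`, `corank_{O_λ}(Sel(T)) ≤ ord_{s=k/2}(L_{p-adic,α}(f)) - 1` if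
`α = p^{(k-2)/2}`", and Rem. 18.3: for `k = 2`, "`α = 1` if and only if `E ⊗ ℚ_p` is a Tate
curve" —: `corank_{ℤ_p} Sel_{p^∞}(E/ℚ) ≤ ord_{T=0} L` at a non-split prime, and
`corank_{ℤ_p} Sel_{p^∞}(E/ℚ) + 1 ≤ ord_{T=0} L` at a split prime. All other inputs are parity-free,
reduction-type-free tree theorems (module docstring); the split clause is
`selmerCorank_succ_le_order_of_charIdeal_datum_X_mul`, the non-split clause
`selmerCorank_le_order_of_charIdeal_datum_of_constantCoeff_ne_zero`.
[cite: Kato2004Asterisque, Thm. 18.4 and Rem. 18.3 (p. 281); Thm. 17.4 (p. 273)]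
[cite: Wuthrich2014, Cor. 19 (p. 398) with proof (p. 399); §3.2 (p. 394)]
[cite: GreenbergLNM1716, §1 p. 65 and §3 Lemma 3.1] -/
theorem selmerCorank_le_order_multiplicative_of_divisibility {ϖ : ℚ} (hϖ0 : ϖ ≠ 0)
    (hdiv : ∀ (κ : ZpExtension ℚ p) (γ : Field.absoluteGaloisGroup ℚ), κ.IsCyclotomic →
      κ.IsTopGenerator γ → IsCyclotomicVariable p γ → ∀ D : W.SelmerDualData κ γ,
      D.IsTorsion ∧
      (¬ W.HasSplitMultiplicativeReductionAtPrime p →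
        ∀ L : PowerSeries ℚ_[p], IsMultPAdicLFunctionOf f p (-1) L →
          ∃ g ∈ D.charIdeal, iwasawaToPowerSeries p g = PowerSeries.C ((ϖ : ℚ) : ℚ_[p]) * L) ∧
      (W.HasSplitMultiplicativeReductionAtPrime p →
        ∀ L : PowerSeries ℚ_[p], IsSplitMultPAdicLFunctionOf f p L →
          ∃ g ∈ D.charIdeal, iwasawaToPowerSeries p (PowerSeries.X * g) =
            PowerSeries.C ((ϖ : ℚ) : ℚ_[p]) * L)) :
    (¬ W.HasSplitMultiplicativeReductionAtPrime p →
        ∀ L : PowerSeries ℚ_[p], IsMultPAdicLFunctionOf f p (-1) L →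
          (W.selmerCorank p : ℕ∞) ≤ L.order) ∧
      (W.HasSplitMultiplicativeReductionAtPrime p →
        ∀ L : PowerSeries ℚ_[p], IsSplitMultPAdicLFunctionOf f p L →
          (W.selmerCorank p : ℕ∞) + 1 ≤ L.order) := by
  obtain ⟨κ, hκ, γ, hγ, hγ'⟩ := exists_isCyclotomic_isTopGenerator_isCyclotomicVariable_holds p
  obtain ⟨D⟩ := W.nonempty_selmerDualData_holds κ γ hγ
  haveI : Module.Finite (IwasawaAlgebra p) D.X :=
    D.module_finite_of_finite_pTorsion_invariants W
      (W.finite_selmerInfty_pTorsion_invariants_holds κ γ) hκ hγ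
  obtain ⟨htors, hns, hsp⟩ := hdiv κ γ hκ hγ hγ' D
  have hu : PowerSeries.constantCoeff (PowerSeries.C ((ϖ : ℚ) : ℚ_[p])) ≠ 0 := by
    rw [PowerSeries.constantCoeff_C]
    exact_mod_cast hϖ0
  refine ⟨fun h L hL ↦ ?_, fun h L hL ↦ ?_⟩
  · obtain ⟨g, hg, hιg⟩ := hns h L hL
    exact selmerCorank_le_order_of_charIdeal_datum_of_constantCoeff_ne_zero W p hγ D htors hg hu hιg
  · obtain ⟨g, hg, hιg⟩ := hsp h L hL
    exact selmerCorank_succ_le_order_of_charIdeal_datum_X_mul W p hγ D htors hg hu hιg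

/-- **The "In particular" of Kato's Thm. 18.4 at a prime of multiplicative reduction, from the
`Λ`-adic divisibility datum** (hypothesis `hdiv` of
`selmerCorank_le_order_multiplicative_of_divisibility`) — Kato, p. 281: "if `k = 2`, `K = ℚ`, and
`f` corresponds to an elliptic curve `E` over `ℚ`, we have `rank(E(ℚ)) ≤ ord_{s=1}(L_{p-adic,α}(f))`
if `E` is not a Tate curve, and `rank(E(ℚ)) ≤ ord_{s=1}(L_{p-adic,α}(f)) - 1` if `E` is a Tate
curve": `rank E(ℚ) ≤ ord_{T=0} L` at a non-split prime and `rank E(ℚ) + 1 ≤ ord_{T=0} L` at a split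
prime, through the Selmer form and `corank Sel_{p^∞}(E/ℚ) = rank E(ℚ) + corank Ш[p^∞]`
(`WeierstrassCurve.selmerCorank_eq_mordellWeilRank_add_holds`).
[cite: Kato2004Asterisque, Thm. 18.4 and Rem. 18.3 (p. 281)]
[cite: Wuthrich2014, Cor. 19 (p. 398)] -/
theorem mordellWeilRank_le_order_multiplicative_of_divisibility {ϖ : ℚ} (hϖ0 : ϖ ≠ 0)
    (hdiv : ∀ (κ : ZpExtension ℚ p) (γ : Field.absoluteGaloisGroup ℚ), κ.IsCyclotomic →
      κ.IsTopGenerator γ → IsCyclotomicVariable p γ → ∀ D : W.SelmerDualData κ γ,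
      D.IsTorsion ∧
      (¬ W.HasSplitMultiplicativeReductionAtPrime p →
        ∀ L : PowerSeries ℚ_[p], IsMultPAdicLFunctionOf f p (-1) L →
          ∃ g ∈ D.charIdeal, iwasawaToPowerSeries p g = PowerSeries.C ((ϖ : ℚ) : ℚ_[p]) * L) ∧
      (W.HasSplitMultiplicativeReductionAtPrime p →
        ∀ L : PowerSeries ℚ_[p], IsSplitMultPAdicLFunctionOf f p L →
          ∃ g ∈ D.charIdeal, iwasawaToPowerSeries p (PowerSeries.X * g) =
            PowerSeries.C ((ϖ : ℚ) : ℚ_[p]) * L)) :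
    (¬ W.HasSplitMultiplicativeReductionAtPrime p →
        ∀ L : PowerSeries ℚ_[p], IsMultPAdicLFunctionOf f p (-1) L →
          (W.mordellWeilRank : ℕ∞) ≤ L.order) ∧
      (W.HasSplitMultiplicativeReductionAtPrime p →
        ∀ L : PowerSeries ℚ_[p], IsSplitMultPAdicLFunctionOf f p L →
          (W.mordellWeilRank : ℕ∞) + 1 ≤ L.order) := by
  obtain ⟨hns, hsp⟩ := selmerCorank_le_order_multiplicative_of_divisibility W p hϖ0 hdiv
  have hk : (W.mordellWeilRank : ℕ∞) ≤ (W.selmerCorank p : ℕ∞) := by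
    have h : W.selmerCorank p = W.mordellWeilRank + W.shaCorank p :=
      W.selmerCorank_eq_mordellWeilRank_add_holds p
    exact_mod_cast h ▸ Nat.le_add_right _ _
  exact ⟨fun h L hL ↦ hk.trans (hns h L hL),
    fun h L hL ↦ (add_le_add hk le_rfl).trans (hsp h L hL)⟩

end Reduction

/-! ### The datum supplied by the tree's published divisibility facts (odd `p`) -/

section Instances

variable (W : WeierstrassCurve ℚ) [W.IsElliptic] [W.IsGloballyMinimal] (p : ℕ) [Fact p.Prime]
  {N : ℕ} [NeZero N] {f : CuspForm (Gamma0 N) 2}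

/-- **Kato's Thm. 18.4 at an odd multiplicative prime with surjective `ρ_{E,p^∞}`** — both
clauses, modulo the named fact `Wuthrich2014.kato_charIdeal_dvd_multiplicative_of_surjective`
(Kato's divisibility at `p ‖ N`: Wuthrich 2014, Thm. 3 and p. 383 "This theorem was proven by
Kato in [10] in the case that the reduction is ordinary and the representation on the Tate module
was surjective"; Cor. 19, first case of the proof, with the `I`-strengthening at a split prime via
Kobayashi 2006 Thm. 4.1, §3.2 p. 394). For a globally minimal `W`, `p ≠ 2` multiplicative,
`ρ̄_{E,p^n}` surjective for every `n`, `f` the newform of `W`, `ϖ · Ω_E = Ω⁺_f`: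
`corank_{ℤ_p} Sel_{p^∞}(E/ℚ) ≤ ord_{T=0} L` for THE non-split function `L`, and
`corank_{ℤ_p} Sel_{p^∞}(E/ℚ) + 1 ≤ ord_{T=0} L` for THE split function `L`.
[cite: Kato2004Asterisque, Thm. 18.4 (p. 281); Thm. 17.4 (p. 273); Thm. 12.5 (4)]
[cite: Wuthrich2014, Thm. 3 and §1 (p. 383); Cor. 19 (p. 398) with proof, first case (p. 399); §3.2 (p. 394)] -/
theorem Wuthrich2014.kato_charIdeal_dvd_multiplicative_of_surjective.selmerCorank_le_order
    (h : Wuthrich2014.kato_charIdeal_dvd_multiplicative_of_surjective)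
    (hp : p ≠ 2) (hmult : W.HasMultiplicativeReductionAtPrime p)
    (hsurj : ∀ n : ℕ, W.HasSurjectiveModNGaloisRep (p ^ n : ℕ)) (hf : IsNewformOf W f)
    (ϖ : ℚ) (hϖ : (ϖ : ℝ) * W.realPeriodRat = plusPeriod f) :
    (¬ W.HasSplitMultiplicativeReductionAtPrime p →
        ∀ L : PowerSeries ℚ_[p], IsMultPAdicLFunctionOf f p (-1) L →
          (W.selmerCorank p : ℕ∞) ≤ L.order) ∧
      (W.HasSplitMultiplicativeReductionAtPrime p →
        ∀ L : PowerSeries ℚ_[p], IsSplitMultPAdicLFunctionOf f p L →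
          (W.selmerCorank p : ℕ∞) + 1 ≤ L.order) :=
  selmerCorank_le_order_multiplicative_of_divisibility W p (hf.periodRatio_ne_zero hϖ)
    fun _ _ hκ hγ hγ' D ↦ h W p hp hmult hsurj hκ hγ hγ' hf D ϖ hϖ

/-- **The "In particular" of Thm. 18.4 at an odd multiplicative prime with surjective
`ρ_{E,p^∞}`**: `rank E(ℚ) ≤ ord_{T=0} L` (non-split), `rank E(ℚ) + 1 ≤ ord_{T=0} L` (split,
"if `E` is a Tate curve"), modulo `Wuthrich2014.kato_charIdeal_dvd_multiplicative_of_surjective`.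
[cite: Kato2004Asterisque, Thm. 18.4 and Rem. 18.3 (p. 281)]
[cite: Wuthrich2014, Thm. 3 and §1 (p. 383); Cor. 19 (p. 398)] -/
theorem Wuthrich2014.kato_charIdeal_dvd_multiplicative_of_surjective.mordellWeilRank_le_order
    (h : Wuthrich2014.kato_charIdeal_dvd_multiplicative_of_surjective)
    (hp : p ≠ 2) (hmult : W.HasMultiplicativeReductionAtPrime p)
    (hsurj : ∀ n : ℕ, W.HasSurjectiveModNGaloisRep (p ^ n : ℕ)) (hf : IsNewformOf W f)
    (ϖ : ℚ) (hϖ : (ϖ : ℝ) * W.realPeriodRat = plusPeriod f) :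
    (¬ W.HasSplitMultiplicativeReductionAtPrime p →
        ∀ L : PowerSeries ℚ_[p], IsMultPAdicLFunctionOf f p (-1) L →
          (W.mordellWeilRank : ℕ∞) ≤ L.order) ∧
      (W.HasSplitMultiplicativeReductionAtPrime p →
        ∀ L : PowerSeries ℚ_[p], IsSplitMultPAdicLFunctionOf f p L →
          (W.mordellWeilRank : ℕ∞) + 1 ≤ L.order) :=
  mordellWeilRank_le_order_multiplicative_of_divisibility W p (hf.periodRatio_ne_zero hϖ)
    fun _ _ hκ hγ hγ' D ↦ h W p hp hmult hsurj hκ hγ hγ' hf D ϖ hϖ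

/-- **At `p ≥ 5`, surjectivity of `ρ̄_{E,p}` suffices** (Serre 1968, IV §3.4: `ρ̄_{E,p}` onto
`GL₂(𝔽_p)` ⇒ every `ρ̄_{E,p^n}` onto — PROVED in the tree,
`serre_hasSurjectiveModNGaloisRep_pow_holds`, packaged as
`Wuthrich2014.kato_charIdeal_dvd_multiplicative_of_surjective.surjective_pow_of_five_le`; this is
the step of Wuthrich's proof of Cor. 19, p. 399): Thm. 18.4, both clauses, at a multiplicative
prime `p ≥ 5` with `ρ̄_{E,p}` surjective, modulo Kato's divisibility fact.
[cite: Kato2004Asterisque, Thm. 18.4 (p. 281)]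
[cite: Wuthrich2014, Cor. 19 proof (p. 399)] [cite: SerreAbelianLadic1968, Ch. IV §3.4] -/
theorem Wuthrich2014.kato_charIdeal_dvd_multiplicative_of_surjective.selmerCorank_le_order_of_five_le
    (h : Wuthrich2014.kato_charIdeal_dvd_multiplicative_of_surjective)
    (hp5 : 5 ≤ p) (hmult : W.HasMultiplicativeReductionAtPrime p)
    (hsurj : W.HasSurjectiveModNGaloisRep p) (hf : IsNewformOf W f)
    (ϖ : ℚ) (hϖ : (ϖ : ℝ) * W.realPeriodRat = plusPeriod f) :
    (¬ W.HasSplitMultiplicativeReductionAtPrime p →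
        ∀ L : PowerSeries ℚ_[p], IsMultPAdicLFunctionOf f p (-1) L →
          (W.selmerCorank p : ℕ∞) ≤ L.order) ∧
      (W.HasSplitMultiplicativeReductionAtPrime p →
        ∀ L : PowerSeries ℚ_[p], IsSplitMultPAdicLFunctionOf f p L →
          (W.selmerCorank p : ℕ∞) + 1 ≤ L.order) :=
  have hp : p ≠ 2 := by omega
  h.selmerCorank_le_order W p hp hmult (surjective_pow_of_five_le W p hp5 hsurj) hf ϖ hϖ

/-- **Kato's Thm. 18.4 at an odd multiplicative prime with `E[p]` REDUCIBLE** — both clauses,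
modulo the named fact `Wuthrich2014.thm16_charIdeal_dvd_multiplicative_of_reducible` (Wuthrich
2014, Thm. 16: at an odd prime of multiplicative reduction with `E[p]` reducible, `X(E/ℚ_∞)` is
`Λ`-torsion and `char_Λ X ∣ (ϖ L_p)`, resp. `T · char_Λ X ∣ (ϖ L_p)` at a split prime).
[cite: Kato2004Asterisque, Thm. 18.4 (p. 281)]
[cite: Wuthrich2014, Thm. 16, Lemma 17 and §5 (p. 397); Cor. 18 (p. 398)] -/
theorem Wuthrich2014.thm16_charIdeal_dvd_multiplicative_of_reducible.selmerCorank_le_order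
    (h : Wuthrich2014.thm16_charIdeal_dvd_multiplicative_of_reducible)
    (hp : p ≠ 2) (hmult : W.HasMultiplicativeReductionAtPrime p)
    (hred : ¬ W.HasIrreducibleModPGaloisRep p) (hf : IsNewformOf W f)
    (ϖ : ℚ) (hϖ : (ϖ : ℝ) * W.realPeriodRat = plusPeriod f) :
    (¬ W.HasSplitMultiplicativeReductionAtPrime p →
        ∀ L : PowerSeries ℚ_[p], IsMultPAdicLFunctionOf f p (-1) L →
          (W.selmerCorank p : ℕ∞) ≤ L.order) ∧
      (W.HasSplitMultiplicativeReductionAtPrime p →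
        ∀ L : PowerSeries ℚ_[p], IsSplitMultPAdicLFunctionOf f p L →
          (W.selmerCorank p : ℕ∞) + 1 ≤ L.order) :=
  selmerCorank_le_order_multiplicative_of_divisibility W p (hf.periodRatio_ne_zero hϖ)
    fun _ _ hκ hγ hγ' D ↦ h W p hp hmult hred hκ hγ hγ' hf D ϖ hϖ

/-- **The "In particular" of Thm. 18.4 at an odd multiplicative prime with `E[p]` reducible**:
`rank E(ℚ) ≤ ord_{T=0} L` (non-split), `rank E(ℚ) + 1 ≤ ord_{T=0} L` (split), modulo
`Wuthrich2014.thm16_charIdeal_dvd_multiplicative_of_reducible`.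
[cite: Kato2004Asterisque, Thm. 18.4 and Rem. 18.3 (p. 281)]
[cite: Wuthrich2014, Thm. 16 and §5 (p. 397)] -/
theorem Wuthrich2014.thm16_charIdeal_dvd_multiplicative_of_reducible.mordellWeilRank_le_order
    (h : Wuthrich2014.thm16_charIdeal_dvd_multiplicative_of_reducible)
    (hp : p ≠ 2) (hmult : W.HasMultiplicativeReductionAtPrime p)
    (hred : ¬ W.HasIrreducibleModPGaloisRep p) (hf : IsNewformOf W f)
    (ϖ : ℚ) (hϖ : (ϖ : ℝ) * W.realPeriodRat = plusPeriod f) :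
    (¬ W.HasSplitMultiplicativeReductionAtPrime p →
        ∀ L : PowerSeries ℚ_[p], IsMultPAdicLFunctionOf f p (-1) L →
          (W.mordellWeilRank : ℕ∞) ≤ L.order) ∧
      (W.HasSplitMultiplicativeReductionAtPrime p →
        ∀ L : PowerSeries ℚ_[p], IsSplitMultPAdicLFunctionOf f p L →
          (W.mordellWeilRank : ℕ∞) + 1 ≤ L.order) :=
  mordellWeilRank_le_order_multiplicative_of_divisibility W p (hf.periodRatio_ne_zero hϖ)
    fun _ _ hκ hγ hγ' D ↦ h W p hp hmult hred hκ hγ hγ' hf D ϖ hϖ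

/-- **Kato's Thm. 18.4 at a multiplicative prime `p ≥ 3` with `E[p]` IRREDUCIBLE on the (ram)
locus** — both clauses, modulo the named fact `Skinner2016.thmA_charIdeal_multiplicative`
(Skinner 2016, Thm. A: the main conjecture at `p ‖ N` under (irr) + (ram), whose divisibility half
is Kato's; split prime: `𝓛_f = (γ - 1) · 𝓛_f'`, §3.3).
[cite: Kato2004Asterisque, Thm. 18.4 (p. 281)]
[cite: Skinner2016PacificMC, Thm. A (§1), §3.2, §3.3] -/
theorem Skinner2016.thmA_charIdeal_multiplicative.selmerCorank_le_order
    (hA : Skinner2016.thmA_charIdeal_multiplicative)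
    (hp3 : 3 ≤ p) (hmult : W.HasMultiplicativeReductionAtPrime p)
    (hirr : W.HasIrreducibleModPGaloisRep p)
    (hram : ∃ ℓ : ℕ, ∃ _ : Fact ℓ.Prime, ℓ ≠ p ∧ W.HasMultiplicativeReductionAtPrime ℓ ∧
      ¬ p ∣ padicValInt ℓ W.minimalDiscriminantInt)
    (hf : IsNewformOf W f) (ϖ : ℚ) (hϖ : (ϖ : ℝ) * W.realPeriodRat = plusPeriod f) :
    (¬ W.HasSplitMultiplicativeReductionAtPrime p →
        ∀ L : PowerSeries ℚ_[p], IsMultPAdicLFunctionOf f p (-1) L →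
          (W.selmerCorank p : ℕ∞) ≤ L.order) ∧
      (W.HasSplitMultiplicativeReductionAtPrime p →
        ∀ L : PowerSeries ℚ_[p], IsSplitMultPAdicLFunctionOf f p L →
          (W.selmerCorank p : ℕ∞) + 1 ≤ L.order) :=
  have hϖ0 : ϖ ≠ 0 := hf.periodRatio_ne_zero hϖ
  selmerCorank_le_order_multiplicative_of_divisibility W p hϖ0 fun _ _ hκ hγ hγ' D ↦
    ⟨Skinner2016.thmA_charIdeal_multiplicative.isTorsion hA W p hp3 hmult hirr hram hκ hγ hγ' hf D
        ϖ hϖ0 hϖ,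
      fun hns L hL ↦ Skinner2016.thmA_charIdeal_multiplicative.exists_mem_charIdeal_nonsplit hA W p
        hp3 hmult hirr hram hκ hγ hγ' hf D ϖ hϖ0 hϖ hns L hL,
      fun hsplit L hL ↦ Skinner2016.thmA_charIdeal_multiplicative.exists_mem_charIdeal_split hA W p
        hp3 hmult hirr hram hκ hγ hγ' hf D ϖ hϖ0 hϖ hsplit L hL⟩

/-- **The "In particular" of Thm. 18.4 at a multiplicative prime `p ≥ 3`, (irr) + (ram)**:
`rank E(ℚ) ≤ ord_{T=0} L` (non-split), `rank E(ℚ) + 1 ≤ ord_{T=0} L` (split), modulo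
`Skinner2016.thmA_charIdeal_multiplicative`.
[cite: Kato2004Asterisque, Thm. 18.4 and Rem. 18.3 (p. 281)]
[cite: Skinner2016PacificMC, Thm. A (§1), §3.2] -/
theorem Skinner2016.thmA_charIdeal_multiplicative.mordellWeilRank_le_order
    (hA : Skinner2016.thmA_charIdeal_multiplicative)
    (hp3 : 3 ≤ p) (hmult : W.HasMultiplicativeReductionAtPrime p)
    (hirr : W.HasIrreducibleModPGaloisRep p)
    (hram : ∃ ℓ : ℕ, ∃ _ : Fact ℓ.Prime, ℓ ≠ p ∧ W.HasMultiplicativeReductionAtPrime ℓ ∧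
      ¬ p ∣ padicValInt ℓ W.minimalDiscriminantInt)
    (hf : IsNewformOf W f) (ϖ : ℚ) (hϖ : (ϖ : ℝ) * W.realPeriodRat = plusPeriod f) :
    (¬ W.HasSplitMultiplicativeReductionAtPrime p →
        ∀ L : PowerSeries ℚ_[p], IsMultPAdicLFunctionOf f p (-1) L →
          (W.mordellWeilRank : ℕ∞) ≤ L.order) ∧
      (W.HasSplitMultiplicativeReductionAtPrime p →
        ∀ L : PowerSeries ℚ_[p], IsSplitMultPAdicLFunctionOf f p L →
          (W.mordellWeilRank : ℕ∞) + 1 ≤ L.order) := by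
  obtain ⟨hns, hsp⟩ := hA.selmerCorank_le_order W p hp3 hmult hirr hram hf ϖ hϖ
  have hk : (W.mordellWeilRank : ℕ∞) ≤ (W.selmerCorank p : ℕ∞) := by
    have h : W.selmerCorank p = W.mordellWeilRank + W.shaCorank p :=
      W.selmerCorank_eq_mordellWeilRank_add_holds p
    exact_mod_cast h ▸ Nat.le_add_right _ _
  exact ⟨fun h L hL ↦ hk.trans (hns h L hL),
    fun h L hL ↦ (add_le_add hk le_rfl).trans (hsp h L hL)⟩

/-- **Assembly at `p ≥ 5`: Kato's Thm. 18.4, both clauses, at a prime of multiplicative reduction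
where `ρ̄_{E,p}` is surjective or `E[p]` is reducible** (Serre's dichotomy for a semi-stable curve,
Wuthrich 2014, proof of Cor. 19, p. 399: "the image of … `ρ̄_p` … is either the whole of `GL₂(𝔽_p)`
or it is contained in a Borel subgroup"), modulo the two Wuthrich-2014 divisibility facts
(`hK` = Kato's surjective case, `h16` = Thm. 16, reducible case). What is NOT covered: `ρ̄_{E,p}`
irreducible and not surjective (outside both facts; for such primes on the (ram) locus see
`Skinner2016.thmA_charIdeal_multiplicative.selmerCorank_le_order`).
[cite: Kato2004Asterisque, Thm. 18.4 (p. 281)]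
[cite: Wuthrich2014, Thm. 3 (p. 383), Thm. 16 (p. 397), Cor. 19 (p. 398) with proof (p. 399)] -/
theorem selmerCorank_le_order_multiplicative_of_five_le
    (hK : Wuthrich2014.kato_charIdeal_dvd_multiplicative_of_surjective)
    (h16 : Wuthrich2014.thm16_charIdeal_dvd_multiplicative_of_reducible)
    (hp5 : 5 ≤ p) (hmult : W.HasMultiplicativeReductionAtPrime p)
    (himg : W.HasSurjectiveModNGaloisRep p ∨ ¬ W.HasIrreducibleModPGaloisRep p)
    (hf : IsNewformOf W f) (ϖ : ℚ) (hϖ : (ϖ : ℝ) * W.realPeriodRat = plusPeriod f) :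
    (¬ W.HasSplitMultiplicativeReductionAtPrime p →
        ∀ L : PowerSeries ℚ_[p], IsMultPAdicLFunctionOf f p (-1) L →
          (W.selmerCorank p : ℕ∞) ≤ L.order) ∧
      (W.HasSplitMultiplicativeReductionAtPrime p →
        ∀ L : PowerSeries ℚ_[p], IsSplitMultPAdicLFunctionOf f p L →
          (W.selmerCorank p : ℕ∞) + 1 ≤ L.order) := by
  rcases himg with hsurj | hred
  · exact hK.selmerCorank_le_order_of_five_le W p hp5 hmult hsurj hf ϖ hϖ
  · exact h16.selmerCorank_le_order W p (by omega) hmult hred hf ϖ hϖ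

/-- **The "In particular" at `p ≥ 5`** (`ρ̄_{E,p}` surjective or `E[p]` reducible): `rank E(ℚ) ≤
ord_{T=0} L` at a non-split prime, `rank E(ℚ) + 1 ≤ ord_{T=0} L` at a split prime ("if `E` is a
Tate curve"), modulo the two Wuthrich-2014 divisibility facts.
[cite: Kato2004Asterisque, Thm. 18.4 and Rem. 18.3 (p. 281)]
[cite: Wuthrich2014, Thm. 3 (p. 383), Thm. 16 (p. 397), Cor. 19 (p. 398)] -/
theorem mordellWeilRank_le_order_multiplicative_of_five_le
    (hK : Wuthrich2014.kato_charIdeal_dvd_multiplicative_of_surjective)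
    (h16 : Wuthrich2014.thm16_charIdeal_dvd_multiplicative_of_reducible)
    (hp5 : 5 ≤ p) (hmult : W.HasMultiplicativeReductionAtPrime p)
    (himg : W.HasSurjectiveModNGaloisRep p ∨ ¬ W.HasIrreducibleModPGaloisRep p)
    (hf : IsNewformOf W f) (ϖ : ℚ) (hϖ : (ϖ : ℝ) * W.realPeriodRat = plusPeriod f) :
    (¬ W.HasSplitMultiplicativeReductionAtPrime p →
        ∀ L : PowerSeries ℚ_[p], IsMultPAdicLFunctionOf f p (-1) L →
          (W.mordellWeilRank : ℕ∞) ≤ L.order) ∧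
      (W.HasSplitMultiplicativeReductionAtPrime p →
        ∀ L : PowerSeries ℚ_[p], IsSplitMultPAdicLFunctionOf f p L →
          (W.mordellWeilRank : ℕ∞) + 1 ≤ L.order) := by
  obtain ⟨hns, hsp⟩ := selmerCorank_le_order_multiplicative_of_five_le W p hK h16 hp5 hmult himg
    hf ϖ hϖ
  have hk : (W.mordellWeilRank : ℕ∞) ≤ (W.selmerCorank p : ℕ∞) := by
    have h : W.selmerCorank p = W.mordellWeilRank + W.shaCorank p :=
      W.selmerCorank_eq_mordellWeilRank_add_holds p
    exact_mod_cast h ▸ Nat.le_add_right _ _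
  exact ⟨fun h L hL ↦ hk.trans (hns h L hL),
    fun h L hL ↦ (add_le_add hk le_rfl).trans (hsp h L hL)⟩

/-- **Existence form at a split prime `p ≥ 5`** (the `p`-adic `L`-function EXISTS and is unique —
tree theorems `exists_isSplitMultPAdicLFunctionOf`, `existsUnique_isSplitMultPAdicLFunctionOf_holds`,
Mazur–Tate–Teitelbaum §I.10–I.14): for `ρ̄_{E,p}` surjective or `E[p]` reducible there is THE
split-multiplicative `L_p(E,T)` and it vanishes at `T = 0` to order `≥ rank E(ℚ) + 1` — the
inequality half of the Mazur–Tate–Teitelbaum "exceptional zero" rank conjecture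
`ord_{s=1} L_p(E,s) = rank E(ℚ) + 1`, modulo the two Wuthrich-2014 divisibility facts.
[cite: Kato2004Asterisque, Thm. 18.4 and Rem. 18.3 (p. 281)]
[cite: MazurTateTeitelbaum1986Invent, §I.10 Prop. and §I.14 (14.3)]
[cite: Wuthrich2014, Cor. 19 (p. 398)] -/
theorem exists_isSplitMultPAdicLFunctionOf_mordellWeilRank_succ_le_order
    (hK : Wuthrich2014.kato_charIdeal_dvd_multiplicative_of_surjective)
    (h16 : Wuthrich2014.thm16_charIdeal_dvd_multiplicative_of_reducible)
    (hp5 : 5 ≤ p) (hsplit : W.HasSplitMultiplicativeReductionAtPrime p)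
    (himg : W.HasSurjectiveModNGaloisRep p ∨ ¬ W.HasIrreducibleModPGaloisRep p)
    (hf : IsNewformOf W f) (ϖ : ℚ) (hϖ : (ϖ : ℝ) * W.realPeriodRat = plusPeriod f) :
    ∃ L : PowerSeries ℚ_[p], IsSplitMultPAdicLFunctionOf f p L ∧
      (W.mordellWeilRank : ℕ∞) + 1 ≤ L.order := by
  obtain ⟨L, hL⟩ := exists_isSplitMultPAdicLFunctionOf hsplit hf
  exact ⟨L, hL, (mordellWeilRank_le_order_multiplicative_of_five_le W p hK h16 hp5
    hsplit.hasMultiplicativeReductionAtPrime himg hf ϖ hϖ).2 hsplit L hL⟩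

end Instances

end Literature.NumberTheory.EllipticCurves

end
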